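import Mathlib
import HarnessLib
import Summits.NavierStokesRegularity.NavierStokesRegularity.Theorems.CompletionRelayChainPhaseISoundField

/-!
# Route `CompletionRelayChain` — crux `RelayFrontStep` (stmt-NavierStokesRegularity-24850), K-side of `stub_phaseI`,
  work package K5-c: ENCLOSURE LEMMAS OF THE CHECKER — interval field range (`mem_fieldIV`), Lagrange jet bound
  (`abs_jet6_le`), Taylor-model jets (`contains_jetTM`), the Lipschitz action `lmB` (`abs_fieldR_sub_le`, `sum_lipM`),
  nonnegativity of `lmB` and of the bootstrap search `bSearch`

MODEL-lattice bookkeeping (rung TL-M3-R64); nothing here is a statement about the Navier–Stokes equations.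
-/

noncomputable section

set_option linter.dupNamespace false

namespace Summit.NavierStokesRegularity.NavierStokesRegularity.Cruxes.RelayFrontStep.PhaseI

open Checker
open Summit.NavierStokesRegularity.NavierStokesRegularity.Theorems.TaylorModelReadout (taylorJet)

/-- The checker's field as a plain function (the shape `taylorJet` and the jet lemmas use). [this file] -/
def fieldF : (Fin 19 → ℝ) → (Fin 19 → ℝ) → Fin 19 → ℝ := fun u v => fieldR u v

/-- `fieldF u v c = bilinOfCoefs coefsR u v c`. [this file] -/
theorem fieldF_apply (u v : Fin 19 → ℝ) (c : Fin 19) : fieldF u v c = bilinOfCoefs coefsR u v c := rfl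

/-! ### Interval enclosures -/

/-- **The level-1 interval field encloses the field on the box.** [this file] -/
theorem mem_fieldIV {B : V19 IV} {y : Fin 19 → ℝ} (hy : ∀ a, IV.mem (B[a]) (y a)) (c : Fin 19) :
    IV.mem ((fieldIV B)[c]) (fieldR y y c) := by
  unfold fieldIV
  simp only [Fin.getElem_fin, Vector.getElem_ofFn, Fin.eta]
  exact evalField_sound (ivOps_sound P) encl_coefs (U := fun a => B[a]) (V := fun a => B[a]) hy hy (fun _ => rfl) c

/-- **The order-6 interval jet bounds the order-6 Taylor jet on the box.** [this file] -/
theorem abs_jet6_le {B : V19 IV} {y : Fin 19 → ℝ} (hy : ∀ a, IV.mem (B[a]) (y a)) (c : Fin 19) :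
    |taylorJet fieldF y 6 c| ≤ (((agetV (jetLevelsV ivOpsP coefsQ B 6) 6 B)[c]).mag : ℝ) := by
  rw [jetV_eq ivOpsP coefsQ B 6 6 le_rfl c]
  exact IV.abs_le_mag (jet_sound (ivOps_sound P) encl_coefs (Y0 := fun c => B[c]) hy 6 6 le_rfl c)

/-- **The Taylor-model jets contain the Taylor jets** of every point contained in the node models. [this file] -/
theorem contains_jetTM {θ : Fin 7 → ℝ} (hθ : TM.InBox θ) {T : V19 (TM 7)} {y : Fin 19 → ℝ}
    (hy : ∀ c, TM.Contains (T[c]) θ (y c)) {j : ℕ} (hj : j ≤ 5) (c : Fin 19) :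
    TM.Contains ((agetV (jetLevelsV tmOps coefsQ T 5) j T)[c]) θ (taylorJet fieldF y j c) := by
  rw [jetV_eq tmOps coefsQ T 5 j hj c]
  exact jet_sound (tmOps_sound hθ) encl_coefs (Y0 := fun c => T[c]) hy j j le_rfl c

/-! ### The Lipschitz action -/

section Lip

variable {ι : Type} [DecidableEq ι] [Fintype ι]

/-- Generic form of `lmB`: `Σ_{e : e.c = c} qmax_e (B_{e.b} d_{e.a} + B_{e.a} d_{e.b})`. [this file] -/
def lipF (l : List (ι × ι × ι × ℚ × ℚ)) (B d : ι → ℝ) (c : ι) : ℝ :=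
  l.foldr (fun e acc => if e.1 = c then (qmax' e : ℝ) * (B e.2.2.1 * d e.2.1 + B e.2.1 * d e.2.2.1) + acc else acc) 0
where
  /-- `max(|lo|,|hi|)` of an entry -/
  qmax' (e : ι × ι × ι × ℚ × ℚ) : ℚ := max |e.2.2.2.1| |e.2.2.2.2|

/-- The matrix whose action is `lipF`. [this file] -/
def lipM (l : List (ι × ι × ι × ℚ × ℚ)) (B : ι → ℝ) (c c' : ι) : ℝ :=
  l.foldr (fun e acc => if e.1 = c then (lipF.qmax' e : ℝ) *
    ((if e.2.1 = c' then B e.2.2.1 else 0) + (if e.2.2.1 = c' then B e.2.1 else 0)) + acc else acc) 0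

/-- `Σ_{c'} lipM c c' · d c' = lipF … d c`. [this file] -/
theorem sum_lipM (l : List (ι × ι × ι × ℚ × ℚ)) (B d : ι → ℝ) (c : ι) :
    ∑ c', lipM l B c c' * d c' = lipF l B d c := by
  induction l with
  | nil => simp [lipM, lipF]
  | cons e l ih =>
    simp only [lipM, lipF, List.foldr_cons] at ih ⊢
    by_cases hc : e.1 = c
    · simp only [if_pos hc, add_mul, Finset.sum_add_distrib, ih]
      congr 1
      simp only [mul_add, add_mul, Finset.sum_add_distrib, mul_ite, mul_zero, ite_mul, zero_mul, Finset.sum_ite_eq,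
        Finset.mem_univ, if_true]
      ring
    · simp only [if_neg hc, ih]

omit [Fintype ι] in
/-- `lipM ≥ 0` for `B ≥ 0`. [this file] -/
theorem lipM_nonneg (l : List (ι × ι × ι × ℚ × ℚ)) {B : ι → ℝ} (hB : ∀ b, 0 ≤ B b) (c c' : ι) : 0 ≤ lipM l B c c' := by
  induction l with
  | nil => simp [lipM]
  | cons e l ih =>
    simp only [lipM, List.foldr_cons] at ih ⊢
    by_cases hc : e.1 = c
    · rw [if_pos hc]
      refine add_nonneg (mul_nonneg ?_ (add_nonneg ?_ ?_)) ih
      · exact_mod_cast (le_max_left _ _).trans' (abs_nonneg _)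
      · split_ifs <;> simp [hB]
      · split_ifs <;> simp [hB]
    · rw [if_neg hc]; exact ih

/-- **Lipschitz bound of a field given by an enclosed coefficient list**: on `|y|,|y'| ≤ B`,
`|Q y y − Q y' y'|_c ≤ lipF l B |y − y'| c`. [this file] -/
theorem abs_bilin_sub_le {lQ : List (ι × ι × ι × ℚ × ℚ)} {lR : List (ι × ι × ι × ℝ)} (hl : Encl lQ lR)
    {B y y' : ι → ℝ} (hy : ∀ b, |y b| ≤ B b) (hy' : ∀ b, |y' b| ≤ B b) (c : ι) :
    |bilinOfCoefs lR y y c - bilinOfCoefs lR y' y' c| ≤ lipF lQ B (fun b => |y b - y' b|) c := by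
  induction hl with
  | nil => simp [bilinOfCoefs_apply, lipF]
  | @cons e f lQ lR hef _ ih =>
    obtain ⟨h1, h2, h3, hlo, hhi⟩ := hef
    rw [bilinOfCoefs_cons, bilinOfCoefs_cons]
    simp only [lipF, List.foldr_cons] at ih ⊢
    have hq : |f.2.2.2| ≤ (lipF.qmax' e : ℝ) := by
      simp only [lipF.qmax']; push_cast
      rw [abs_le]; constructor
      · have : -(max |(e.2.2.2.1 : ℝ)| |(e.2.2.2.2 : ℝ)|) ≤ (e.2.2.2.1 : ℝ) := by
          linarith [neg_abs_le (e.2.2.2.1 : ℝ), le_max_left |(e.2.2.2.1 : ℝ)| |(e.2.2.2.2 : ℝ)|]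
        linarith
      · linarith [le_abs_self (e.2.2.2.2 : ℝ), le_max_right |(e.2.2.2.1 : ℝ)| |(e.2.2.2.2 : ℝ)|]
    by_cases hc : e.1 = c
    · have hc' : c = f.1 := by rw [← h1, hc]
      rw [if_pos hc', if_pos hc', if_pos hc, ← h2, ← h3]
      set a := e.2.1; set b := e.2.2.1; set q := f.2.2.2
      have key : |q * (y a * y b) - q * (y' a * y' b)| ≤ (lipF.qmax' e : ℝ) * (B b * |y a - y' a| + B a * |y b - y' b|) := by
        have e1 : q * (y a * y b) - q * (y' a * y' b) = q * ((y a - y' a) * y b + y' a * (y b - y' b)) := by ring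
        rw [e1, abs_mul]
        refine mul_le_mul hq ?_ (abs_nonneg _) ((abs_nonneg _).trans hq)
        refine (abs_add_le _ _).trans ?_
        rw [abs_mul, abs_mul]
        have := hy b; have := hy' a
        nlinarith [abs_nonneg (y a - y' a), abs_nonneg (y b - y' b), abs_nonneg (y b), abs_nonneg (y' a)]
      calc |q * (y a * y b) + bilinOfCoefs lR y y c - (q * (y' a * y' b) + bilinOfCoefs lR y' y' c)|
          = |(q * (y a * y b) - q * (y' a * y' b)) + (bilinOfCoefs lR y y c - bilinOfCoefs lR y' y' c)| := by ring_nf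
        _ ≤ _ := (abs_add_le _ _).trans (add_le_add key ih)
    · have hc' : ¬ c = f.1 := fun h => hc (h1.trans h.symm)
      rw [if_neg hc', if_neg hc', if_neg hc]
      simpa using ih

end Lip

/-- `lmB` is the rational form of `lipF coefsQ`. [this file] -/
theorem lmB_cast (mag b : V19 ℚ) (c : Fin 19) :
    ((lmB mag b c : ℚ) : ℝ) = lipF coefsQ (fun a => (mag[a] : ℝ)) (fun a => (b[a] : ℝ)) c := by
  unfold lmB lipF
  generalize coefsQ = l
  induction l with
  | nil => simp
  | cons e l ih =>
    simp only [List.foldr_cons]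
    by_cases hc : e.1 = c
    · rw [if_pos hc, if_pos hc]; push_cast; rw [ih]; simp [qmax, lipF.qmax']
    · rw [if_neg hc, if_neg hc, ih]

/-- **Lipschitz bound of the checker's field with the checker's `lmB`.** [this file] -/
theorem abs_fieldR_sub_le {mag : V19 ℚ} {y y' : Fin 19 → ℝ} (hy : ∀ b, |y b| ≤ (mag[b] : ℝ))
    (hy' : ∀ b, |y' b| ≤ (mag[b] : ℝ)) (c : Fin 19) :
    |fieldR y y c - fieldR y' y' c| ≤ ∑ c', lipM coefsQ (fun a => (mag[a] : ℝ)) c c' * |y c' - y' c'| := by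
  rw [sum_lipM]
  exact abs_bilin_sub_le encl_coefs hy hy' c

/-! ### Nonnegativity of the bootstrap data -/

/-- `IV.mag ≥ 0`. [this file] -/
theorem IV.mag_nonneg (I : IV) : 0 ≤ I.mag := (abs_nonneg _).trans (le_max_left _ _)

/-- `lmB ≥ 0` for nonnegative `mag`, `b`. [this file] -/
theorem lmB_nonneg {mag b : V19 ℚ} (hm : ∀ c : Fin 19, (0 : ℚ) ≤ mag[c]) (hb : ∀ c : Fin 19, (0 : ℚ) ≤ b[c])
    (c : Fin 19) : 0 ≤ lmB mag b c := by
  unfold lmB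
  generalize coefsQ = l
  induction l with
  | nil => simp
  | cons e l ih =>
    simp only [List.foldr_cons]
    by_cases hc : e.1 = c
    · rw [if_pos hc]
      refine add_nonneg (mul_nonneg ((abs_nonneg _).trans (le_max_left _ _)) ?_) ih
      exact add_nonneg (mul_nonneg (hm _) (hb _)) (mul_nonneg (hm _) (hb _))
    · rw [if_neg hc]; exact ih

/-- The bootstrap search keeps nonnegative vectors nonnegative. [this file] -/
theorem bSearch_nonneg {mag D : V19 ℚ} (hm : ∀ c : Fin 19, (0 : ℚ) ≤ mag[c]) (hD : ∀ c : Fin 19, (0 : ℚ) ≤ D[c]) :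
    ∀ (fuel : ℕ) {b : V19 ℚ}, (∀ c : Fin 19, (0 : ℚ) ≤ b[c]) → ∀ c : Fin 19, (0 : ℚ) ≤ (bSearch mag D fuel b)[c]
  | 0, _, hb, c => by simpa [bSearch] using hb c
  | fuel + 1, b, hb, c => by
    simp only [bSearch]
    refine bSearch_nonneg hm hD fuel (fun c' => ?_) c
    simp only [Fin.getElem_fin, Vector.getElem_ofFn]
    have h1 : 0 ≤ h * (lmB mag b c' + D[c']) := mul_nonneg (by norm_num [Checker.h]) (add_nonneg (lmB_nonneg hm hb c') (hD _))
    positivity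

end Summit.NavierStokesRegularity.NavierStokesRegularity.Cruxes.RelayFrontStep.PhaseI

end
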